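import Summits.MatrixMultiplication.MatrixMultiplication.Theorems.SoloInformedConstantClass

/-!
# The fourth laziness bound: rows of `b` class-constant along `k` (every chart)

This work, §8.8 (T10) (gen 107). Setting of `SoloInformedTransfer`: twisted data `a b c` over the odd part
`G = S¹` with (E), a chart `Φ = (f, g, l)` into `G₀ = S⁰`, full separation `Data.SepAll`, a class map
`κ : G → R` (`κ x = κ y → SignEq x y`), rank `= |S⁰| · r`.

The map `Ψ_a : (i, j, k) ↦ ([a i j], F i j k)` collides only on same-fibre pairs with equal `a`-class, and such a
pair forces the row `j` of `b` to take inequivalent values at the two columns involved: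
* `Data.a_not_signEq_of_b_row` — `b j k'' ~ b j k` and `Sep (i', j', k'') (i, j, k)` give `a i' j' ≁ a i j`
  ((E) at `(i, j, k)`, class invariance in the first two slots).
* `Data.card_mul_le_of_b_rowConstOn₂` — if every row `j ∈ J₀` of `b` is class-constant on the columns `k ∈ K₁`
  (the constant may depend on `j`), then `n · |J₀| · |K₁| ≤ r · |S⁰|` (translate-averaging over the `a`-cells
  `(i, j)`, `j ∈ J₀`, chart `f i + g j`, `T = l(K₁)`).
* `Data.cube_le_of_b_rowConst` — `b` row-lazy in `k` everywhere ⟹ `n³ ≤ r · |S⁰|` (rank ≥ n³).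
Together with `card_mul_le_of_b_rowsOn₂` (rows agreeing = constant along `j`) BOTH lazy directions of `b` on an
aligned rectangle `J₀ × K₁` give `n |J₀| |K₁| ≤ r |S⁰|`.
References: this work §8.8; CohnUmans2013 (arXiv:1207.6528) Def. 12.
-/

open Pointwise

namespace Summit.MatrixMultiplication.MatrixMultiplication.Theorems.TwistedTPP

namespace FibreLines

variable {ι G : Type*} [AddCommGroup G]

/-- `b j k'' ~ b j k` and `Sep (i', j', k'') (i, j, k)` force `a i' j' ≁ a i j`. [this work, §8.8 (T10)] -/
theorem Data.a_not_signEq_of_b_row (D : Data ι G) {i j k i' j' k'' : ι}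
    (hb : SignEq (D.b j k'') (D.b j k)) (h : D.Sep i' j' k'' i j k) : ¬ SignEq (D.a i' j') (D.a i j) := by
  intro ha
  apply (D.sep_iff_not_adm i' j' k'' i j k).mp h
  exact ((D.adm_eqn i j k).of_signEq_left ha.symm).of_signEq_mid hb.symm

variable {G₀ R : Type*} [AddCommGroup G₀]

/-- **Rows `j ∈ J₀` of `b` class-constant on the columns `k ∈ K₁` ⟹ `n · |J₀| · |K₁| ≤ r · |S⁰|`**
(the constants may depend on `j`; averaging over the `a`-cells `(i, j)`, `j ∈ J₀`, chart `f i + g j`,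
`T = l(K₁)`). [this work, §8.8 (T10)] -/
theorem Data.card_mul_le_of_b_rowConstOn₂ [Fintype ι] [DecidableEq ι] [Fintype G₀] [DecidableEq G₀]
    [Fintype R] [DecidableEq R] (D : Data ι G) (Φ : Chart ι G₀) (κ : G → R)
    (hκ : ∀ x y, κ x = κ y → SignEq x y) (hsep : D.SepAll Φ) (J₀ K₁ : Finset ι)
    (hb : ∀ j ∈ J₀, ∀ k ∈ K₁, ∀ k'' ∈ K₁, SignEq (D.b j k'') (D.b j k)) :
    Fintype.card ι * J₀.card * K₁.card ≤ Fintype.card R * Fintype.card G₀ := by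
  classical
  rcases J₀.eq_empty_or_nonempty with hJ | ⟨j₀, hj₀⟩
  · simp [hJ]
  rcases isEmpty_or_nonempty ι with hι | ⟨⟨i₀⟩⟩
  · simp
  have hl : Set.InjOn Φ.l ↑K₁ := by
    intro k hk k'' hk'' hll
    by_contra hne
    have hF : Φ.F i₀ j₀ k'' = Φ.F i₀ j₀ k := by simp [Chart.F, hll]
    have hs := hsep i₀ j₀ k'' i₀ j₀ k hF (by simp [Ne.symm hne])
    exact D.a_not_signEq_of_b_row (hb j₀ hj₀ k hk k'' hk'') hs (SignEq.refl _)
  have hT : (K₁.image Φ.l).card = K₁.card := Finset.card_image_of_injOn hl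
  have key := card_mul_card_le_of_sub_mem_sub_on (X := ι × ι) (fun x => Φ.f x.1 + Φ.g x.2)
    (fun x => κ (D.a x.1 x.2)) ((Finset.univ : Finset ι) ×ˢ J₀) (K₁.image Φ.l) Finset.univ
    (fun _ _ _ _ => Finset.mem_univ _) ?_
  · have hX : ((Finset.univ : Finset ι) ×ˢ J₀).card = Fintype.card ι * J₀.card := by
      simp [Finset.card_product]
    rw [hX, hT, Finset.card_univ] at key
    exact key
  · rintro ⟨i, j⟩ hx ⟨i', j'⟩ hx' hne hmem hκeq
    simp only [Finset.mem_product, Finset.mem_univ, true_and] at hx hx'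
    rw [Finset.mem_sub] at hmem
    obtain ⟨t, ht, t', ht', htt⟩ := hmem
    rw [Finset.mem_image] at ht ht'
    obtain ⟨k'', hk'', rfl⟩ := ht
    obtain ⟨k, hk, rfl⟩ := ht'
    -- τ = (i, j, k) and τ' = (i', j', k'') lie in one fibre
    have hF : Φ.F i' j' k'' = Φ.F i j k := by
      simp only [Chart.F]
      have e : Φ.f i + Φ.g j - (Φ.f i' + Φ.g j') = Φ.l k'' - Φ.l k := by simpa using htt.symm
      have e2 : Φ.f i' + Φ.g j' + Φ.l k'' - (Φ.f i + Φ.g j + Φ.l k) =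
          (Φ.l k'' - Φ.l k) - (Φ.f i + Φ.g j - (Φ.f i' + Φ.g j')) := by abel
      rw [← sub_eq_zero, e2, e, sub_self]
    have hneq : (i', j', k'') ≠ (i, j, k) := by
      intro heq
      simp only [Prod.mk.injEq] at heq
      exact hne (by rw [heq.1, heq.2.1])
    have hs := hsep i' j' k'' i j k hF hneq
    exact D.a_not_signEq_of_b_row (hb j hx k hk k'' hk'') hs ((hκ _ _ hκeq).symm)

/-- **`b` row-lazy in `k` ⟹ rank ≥ n³ (every chart):** if every row of `b` is class-constant, then
`n³ ≤ r · |S⁰|`. [this work, §8.8 (T10)] -/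
theorem Data.cube_le_of_b_rowConst [Fintype ι] [DecidableEq ι] [Fintype G₀] [DecidableEq G₀]
    [Fintype R] [DecidableEq R] (D : Data ι G) (Φ : Chart ι G₀) (κ : G → R)
    (hκ : ∀ x y, κ x = κ y → SignEq x y) (hsep : D.SepAll Φ)
    (hb : ∀ j k k'', SignEq (D.b j k'') (D.b j k)) :
    Fintype.card ι ^ 3 ≤ Fintype.card R * Fintype.card G₀ := by
  have h := D.card_mul_le_of_b_rowConstOn₂ Φ κ hκ hsep Finset.univ Finset.univ
    (fun j _ k _ k'' _ => hb j k k'')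
  rw [Finset.card_univ] at h
  calc Fintype.card ι ^ 3 = Fintype.card ι * Fintype.card ι * Fintype.card ι := by ring
    _ ≤ Fintype.card R * Fintype.card G₀ := h

/-- **Two-direction cover for `b`.** If every row `j` of `b` is class-constant on a common column set `K₁`, OR all
rows `j ∈ J₀` agree in class on `K₁`, the rectangle `J₀ × K₁` pays `n |J₀| |K₁| ≤ r |S⁰|` either way; this is
the form used by the alignment lemma. [this work, §8.8 (T10)] -/
theorem Data.card_mul_le_of_b_lazyOn₂ [Fintype ι] [DecidableEq ι] [Fintype G₀] [DecidableEq G₀]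
    [Fintype R] [DecidableEq R] (D : Data ι G) (Φ : Chart ι G₀) (κ : G → R)
    (hκ : ∀ x y, κ x = κ y → SignEq x y) (hsep : D.SepAll Φ) (J₀ K₁ : Finset ι)
    (hb : (∀ j ∈ J₀, ∀ k ∈ K₁, ∀ k'' ∈ K₁, SignEq (D.b j k'') (D.b j k)) ∨
      (∀ j ∈ J₀, ∀ j' ∈ J₀, ∀ k ∈ K₁, SignEq (D.b j' k) (D.b j k))) :
    Fintype.card ι * J₀.card * K₁.card ≤ Fintype.card R * Fintype.card G₀ := by
  rcases hb with hb | hb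
  · exact D.card_mul_le_of_b_rowConstOn₂ Φ κ hκ hsep J₀ K₁ hb
  · have h := D.card_mul_le_of_b_rowsOn₂ Φ κ hκ hsep J₀ K₁ hb
    calc Fintype.card ι * J₀.card * K₁.card = Fintype.card ι * K₁.card * J₀.card := by ring
      _ ≤ Fintype.card R * Fintype.card G₀ := h

end FibreLines

end Summit.MatrixMultiplication.MatrixMultiplication.Theorems.TwistedTPP
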